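/-
Copyright (c) 2026 the pub-hodgecm-mathlib formalisation cell (harness21).  Prover seat hodgecm-mathlib-F0P3a-p01 (g37), FLOOR 0, SUPPORTS-ONLY on h413; β-BOARD v1 R10
(assembler ∕ chair): the `hRest` glue, part 5 — THE REST SUM EQUALS `restTarget` MODULO THE SEVEN LATTICE ROWS (★ assembly ∘ ★ `harith_of_values` at LH4-p10's letters).  2026-09-04.
-/
import Summits.HodgeConjecture.HodgeConjecture.Theorems.F0P3cDyRamOddLabelledRestAssembly      -- ★-pending p861863 (this seat): `restSum_eq_of_rows`; brings the trunk ★ p861403 and the record lemmas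
import Summits.HodgeConjecture.HodgeConjecture.Theorems.F0P3cDyRamOddLabelledRestArith         -- ★ p861847 (LH4-p10 (g6)): `harith_of_values`
import HarnessLib

/-!
# Crux `H413`, LH4 «(D-RAM) FOUR-FRAME» road, STAGE 1b (β) — THE `hRest` GLUE, PART 5: THE REST SUM EQUALS `restTarget` MODULO THE SEVEN LATTICE ROWS

Cell `hodgecm-mathlib` (D-0151), FLOOR 0, crux item H413 = `stmt-HodgeConjecture-24833`, route `HCCMUnconditional`; squad F0∕P3c∕LH4.  THEOREMS ONLY (no `def`, no instance, no
notation, no `sorry`, default heartbeats); lane `--supports stmt-HodgeConjecture-24833 --as helper` (count-neutral; pays NO row).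

WHAT THIS FILE DOES (chair's LEDGER #15∕#16).  ★ `restSum_eq_of_rows` (part 4) reduces the (T2) trunk's `hRest` instance at one derived-record datum and slot `i` to eleven binders;
★ p861847 `harith_of_values` (LH4-p10 (g6)) pays the arithmetic one, `harith`, once the VALUE LETTERS are fixed.  Here the letters ARE fixed — `VH ρ := [2ρ + ℓ₀ = min n₁ n₂] ·
(LH4-p10's hanging vector)_i`, `κ_k ρ s i :=` LH4-p10's κ-class closed forms (symmetric token pairs `(ω_A + ω(−1)ω_C)∕4`, `(ω_B + ω_C)∕4`, `(ω(−1)ω_B + ω(−1)ω_A)∕4`, exponent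
`q^(2ρ−1+s∕2)`, bracket read at `n₁ ∕ n₂ ∕ n₃`), `VG` the dispatchers' columns — so that `hVG0∕1∕2`, `hκ0∕1∕2`, `hVH0∕1` are `rfl` ∕ `if_pos` ∕ `if_neg`, and the regime letters
of `harith_of_values` (`2 ≤ d`, isosceles, `3d − 2 + ℓ₀ ≤ n_j`, parities) are discharged from the record.  What is LEFT are the SEVEN LATTICE ROWS, as binders with fully explicit
right-hand sides in the tokens `e_A, e_B, e_C` of the datum: `hH` (R8 hanging line, LH4-p05 (g9) junction over LH7-p08∕p09 (g0)), `hC₁`∕`hC₂` (R7-C windows), `hF₃` (tower-3 foot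
line, LH7-p07 (g0)), `hR6₁`∕`hR6₂`∕`hR6₃` (κ lines, LH4-p07 (g10) junctions over LH4-p11 (g9)∕LH4-p08 (g10)).  Conclusion: the trunk's `hRest` body VERBATIM at that datum and slot —
`Σ_a [IsRestShape] · v_i(a) = restTarget (Fintype.card 𝓀) d n₁ n₂ n₃ (normSign σ e_A) (normSign σ e_B) (normSign σ e_C) (normSign σ (−1)) i`.
HONEST LABEL.  Count-neutral glue; the seven rows are hypotheses; `hRest`, (β) OPEN; `HC_CM` is proved only modulo the 7 printed citations (2 remaining named inputs: hLiu418 =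
`stmt-HodgeConjecture-24832`, h413 = `stmt-HodgeConjecture-24833`) until rung 0 closes.

## References
* [Kottwitz1986BaseChangeUnits] R. E. Kottwitz, *Base change for unit elements of Hecke algebras*, Compositio Math. 60 (1986), §1 pp. 240–241 (lattice counts by strata).
* [Rogawski1990] J. D. Rogawski, *Automorphic Representations of Unitary Groups in Three Variables*, Ann. of Math. Stud. 123 (1990), §4.9 Prop. 4.9.1 (a)(b) p. 55.
-/

set_option autoImplicit false

noncomputable section

namespace Summit.HodgeConjecture.HodgeConjecture.Cruxes.H413.F0P3cDyRamOddLabelledRestOfRows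

open Literature.NumberTheory.Automorphic Literature.NumberTheory.Automorphic.HermitianLattice Literature.NumberTheory.Automorphic.UnitaryGroup
open Literature.NumberTheory.Automorphic.UnitaryLatticeTree Literature.NumberTheory.Automorphic.UnitaryThreeFourFrame
open Summit.HodgeConjecture.HodgeConjecture.Cruxes.H413.F0P3cDyRamFourFramePieces
open Summit.HodgeConjecture.HodgeConjecture.Cruxes.H413.F0P3cDyRamFourFrameCensusDefs
open Summit.HodgeConjecture.HodgeConjecture.Cruxes.H413.F0P3cDyRamStageOneBDefs (mcOfRecord)
open Summit.HodgeConjecture.HodgeConjecture.Cruxes.H413.F0P3cDyRamStageOneBDerivedDefs (n0DerivedOfRecord)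
open Summit.HodgeConjecture.HodgeConjecture.Cruxes.H413.F0P3cDyRamDiagonalTorusDefs
open Summit.HodgeConjecture.HodgeConjecture.Cruxes.H413.F0P3cDyRamDiagonalStrataDefs
open Summit.HodgeConjecture.HodgeConjecture.Cruxes.H413.F0P3cDyRamLabelledOddCountDefs
open Summit.HodgeConjecture.HodgeConjecture.Cruxes.H413.F0P3cDyRamOddLabelledBoxSumDefs (IsRestShape restTarget)
open Summit.HodgeConjecture.HodgeConjecture.Cruxes.H413.F0P3cDyRamOddLabelledRestAssembly (restSum_eq_of_rows)
open Summit.HodgeConjecture.HodgeConjecture.Cruxes.H413.F0P3cDyRamOddLabelledRestArith (harith_of_values)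
open Summit.HodgeConjecture.HodgeConjecture.Cruxes.H413.F0P3cDyRamLabelledOddStageBTable (three_mul_sub_two_add_mod_le_n0DerivedOfRecord)
open Summit.HodgeConjecture.HodgeConjecture.Cruxes.H413.F0P3cDyRamElementDatumParity (isoceles_of_isElementDatum depth_mod_two_eq_of_isElementDatum)
open Summit.HodgeConjecture.HodgeConjecture.Cruxes.H413.F0P3cDyRamDiagonalKappaCoreHangingClass (two_le_d_of_v_two_lt_one)
open scoped Valued WithZero Matrix MatrixGroups

variable {K : Type} [Field K] [Valued K ℤᵐ⁰] {σ : K →+* K} {ϖ : K} {d t : ℕ} {α β : K} {n₁ n₂ n₃ : ℕ}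

/-- **THE REST SUM EQUALS `restTarget`, MODULO THE SEVEN LATTICE ROWS.**  At a derived-record datum with tower-sign tokens `eA eB eC` (any elements here — the rows carry them)
and a slot `i`: IF the hanging line `H(ρ)` carries LH4-p10's `VH` (binder `hH`), the windows of towers 1∕2 and the foot line of tower 3 vanish (`hC₁ hC₂ hF₃`), and the κ-loci
of the three towers carry LH4-p10's closed forms (`hR6₁ hR6₂ hR6₃`), THEN `Σ_a [IsRestShape] · v_i(a) = restTarget q d n₁ n₂ n₃ ω_A ω_B ω_C ω(−1) i` — the (T2) trunk's `hRest`
body at that datum and slot (★ `restSum_eq_of_rows` ∘ ★ `harith_of_values`; every arithmetic letter `rfl`). [cite: Kottwitz1986BaseChangeUnits, §1 pp. 240–241]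
[cite: Rogawski1990, §4.9 Prop. 4.9.1 (a)(b) p. 55] -/
theorem restSum_eq_restTarget_of_rows [CompleteSpace K] [Fintype 𝓀[K]] (h2 : Valued.v (2 : K) < 1) (hD : IsRamifiedQuadraticDatum σ ϖ d t)
    (hE : IsElementDatum σ ϖ (n0DerivedOfRecord d) α β n₁ n₂ n₃)
    (T : GL (Fin 3) K) (hT : (T : Matrix (Fin 3) (Fin 3) K) = Matrix.diagonal ![α, β, 1]) (eA eB eC : K) (i : Fin 3)
    (hH : ∀ ρ : ℕ, 1 ≤ ρ → 2 * ρ ≤ n₁ + n₂ + n₃ →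
      ∑ᶠ M ∈ {M : Submodule 𝒪[K] (Fin 3 → K) | M ∈ stratum σ ϖ T ![2 * ρ, 2 * ρ, 2 * ρ] ∧
          (LatticeInLevel ϖ (d % 2) (Matrix.diagonal ![α - 1, β - 1, 0]) M ∧ ¬ LatticeInLevel ϖ (d % 2 + 1) (Matrix.diagonal ![α - 1, β - 1, 0]) M ∧
            LatticeInLevel ϖ (mcOfRecord d) (Matrix.diagonal ![(α - 1) * (α - 1), (β - 1) * (β - 1), 0]) M)},
        (labelledOddCount σ ϖ 0 i (valueClassLabel σ ϖ (α - 1) (β - 1) (mstarOfRecord d) d) M : ℚ) /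
          ((((unitStabilizer M).map (unitNormMap σ 3)).relIndex (fixedUnitTorus σ 3) : ℕ) : ℚ) =
      (if 2 * ρ + d % 2 = min n₁ n₂ then
        (![if n₂ = n₃ then ((normSign σ eA : ℚ) + (normSign σ (-1 : K) : ℚ) * (normSign σ eC : ℚ)) / 4 * (Fintype.card 𝓀[K] : ℚ) ^ (n₂ - d % 2 - 1)
            * ((if n₂ + 2 * d ≤ n₁ then (Fintype.card 𝓀[K] : ℚ) - 2 else 0) - (if n₁ + 2 = n₂ + 2 * d then 2 else 0)) else 0,
          if n₁ = n₃ then ((normSign σ eB : ℚ) + (normSign σ eC : ℚ)) / 4 * (Fintype.card 𝓀[K] : ℚ) ^ (n₁ - d % 2 - 1)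
            * ((if n₁ + 2 * d ≤ n₂ then (Fintype.card 𝓀[K] : ℚ) - 2 else 0) - (if n₂ + 2 = n₁ + 2 * d then 2 else 0)) else 0,
          if n₁ = n₂ then ((normSign σ (-1 : K) : ℚ) * (normSign σ eB : ℚ) + (normSign σ (-1 : K) : ℚ) * (normSign σ eA : ℚ)) / 4 * (Fintype.card 𝓀[K] : ℚ) ^ (n₁ - d % 2 - 1)
            * ((if n₁ + 2 * d ≤ n₃ then (Fintype.card 𝓀[K] : ℚ) - 2 else 0) - (if n₃ + 2 = n₁ + 2 * d then 2 else 0)) else 0] : Fin 3 → ℚ) i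
       else 0))
    (hC₁ : ∀ (ρ s : ℕ), 1 ≤ ρ → 1 ≤ s → n₁ = n₂ + s → n₂ ≤ 2 * ρ + d % 2 → 2 * ρ + mcOfRecord d ≤ 2 * n₂ → ∀ i : Fin 3,
      ∑ᶠ M ∈ {M : Submodule 𝒪[K] (Fin 3 → K) | M ∈ stratum σ ϖ T ![2 * ρ, 2 * ρ + s, 2 * ρ + s] ∧
          (LatticeInLevel ϖ (d % 2) (Matrix.diagonal ![α - 1, β - 1, 0]) M ∧ ¬ LatticeInLevel ϖ (d % 2 + 1) (Matrix.diagonal ![α - 1, β - 1, 0]) M ∧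
            LatticeInLevel ϖ (mcOfRecord d) (Matrix.diagonal ![(α - 1) * (α - 1), (β - 1) * (β - 1), 0]) M)},
        (labelledOddCount σ ϖ 0 i (valueClassLabel σ ϖ (α - 1) (β - 1) (mstarOfRecord d) d) M : ℚ) /
          ((((unitStabilizer M).map (unitNormMap σ 3)).relIndex (fixedUnitTorus σ 3) : ℕ) : ℚ) = 0)
    (hR6₁ : ∀ (ρ s : ℕ), 1 ≤ ρ → 1 ≤ s → 2 ∣ s → 2 * ρ + d % 2 = n₂ → n₁ ≠ n₂ + s → ∀ i : Fin 3,
      ∑ᶠ M ∈ {M : Submodule 𝒪[K] (Fin 3 → K) | M ∈ stratum σ ϖ T ![2 * ρ, 2 * ρ + s, 2 * ρ + s] ∧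
          (LatticeInLevel ϖ (d % 2) (Matrix.diagonal ![α - 1, β - 1, 0]) M ∧ ¬ LatticeInLevel ϖ (d % 2 + 1) (Matrix.diagonal ![α - 1, β - 1, 0]) M ∧
            LatticeInLevel ϖ (mcOfRecord d) (Matrix.diagonal ![(α - 1) * (α - 1), (β - 1) * (β - 1), 0]) M)},
        (labelledOddCount σ ϖ 0 i (valueClassLabel σ ϖ (α - 1) (β - 1) (mstarOfRecord d) d) M : ℚ) /
          ((((unitStabilizer M).map (unitNormMap σ 3)).relIndex (fixedUnitTorus σ 3) : ℕ) : ℚ) =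
      (![(normSign σ eA : ℚ) + (normSign σ (-1 : K) : ℚ) * (normSign σ eC : ℚ), 0, 0] : Fin 3 → ℚ) i / 4 * (Fintype.card 𝓀[K] : ℚ) ^ (2 * ρ - 1 + s / 2)
        * ((if 2 * d + d % 2 + 2 * ρ + s ≤ n₁ then (Fintype.card 𝓀[K] : ℚ) - 1 else 0) - (if n₁ + 2 = 2 * d + d % 2 + 2 * ρ + s then 1 else 0)))
    (hC₂ : ∀ (ρ s : ℕ), 1 ≤ ρ → 1 ≤ s → n₂ = n₁ + s → n₁ ≤ 2 * ρ + d % 2 → 2 * ρ + mcOfRecord d ≤ 2 * n₁ → ∀ i : Fin 3,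
      ∑ᶠ M ∈ {M : Submodule 𝒪[K] (Fin 3 → K) | M ∈ stratum σ ϖ T ![2 * ρ + s, 2 * ρ, 2 * ρ + s] ∧
          (LatticeInLevel ϖ (d % 2) (Matrix.diagonal ![α - 1, β - 1, 0]) M ∧ ¬ LatticeInLevel ϖ (d % 2 + 1) (Matrix.diagonal ![α - 1, β - 1, 0]) M ∧
            LatticeInLevel ϖ (mcOfRecord d) (Matrix.diagonal ![(α - 1) * (α - 1), (β - 1) * (β - 1), 0]) M)},
        (labelledOddCount σ ϖ 0 i (valueClassLabel σ ϖ (α - 1) (β - 1) (mstarOfRecord d) d) M : ℚ) /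
          ((((unitStabilizer M).map (unitNormMap σ 3)).relIndex (fixedUnitTorus σ 3) : ℕ) : ℚ) = 0)
    (hR6₂ : ∀ (ρ s : ℕ), 1 ≤ ρ → 1 ≤ s → 2 ∣ s → 2 * ρ + d % 2 = n₁ → n₂ ≠ n₁ + s → ∀ i : Fin 3,
      ∑ᶠ M ∈ {M : Submodule 𝒪[K] (Fin 3 → K) | M ∈ stratum σ ϖ T ![2 * ρ + s, 2 * ρ, 2 * ρ + s] ∧
          (LatticeInLevel ϖ (d % 2) (Matrix.diagonal ![α - 1, β - 1, 0]) M ∧ ¬ LatticeInLevel ϖ (d % 2 + 1) (Matrix.diagonal ![α - 1, β - 1, 0]) M ∧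
            LatticeInLevel ϖ (mcOfRecord d) (Matrix.diagonal ![(α - 1) * (α - 1), (β - 1) * (β - 1), 0]) M)},
        (labelledOddCount σ ϖ 0 i (valueClassLabel σ ϖ (α - 1) (β - 1) (mstarOfRecord d) d) M : ℚ) /
          ((((unitStabilizer M).map (unitNormMap σ 3)).relIndex (fixedUnitTorus σ 3) : ℕ) : ℚ) =
      (![(0 : ℚ), (normSign σ eB : ℚ) + (normSign σ eC : ℚ), 0] : Fin 3 → ℚ) i / 4 * (Fintype.card 𝓀[K] : ℚ) ^ (2 * ρ - 1 + s / 2)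
        * ((if 2 * d + d % 2 + 2 * ρ + s ≤ n₂ then (Fintype.card 𝓀[K] : ℚ) - 1 else 0) - (if n₂ + 2 = 2 * d + d % 2 + 2 * ρ + s then 1 else 0)))
    (hF₃ : ∀ (ρ s : ℕ), 1 ≤ ρ → 1 ≤ s → 2 ∣ s → n₃ = n₂ + s → ∀ i : Fin 3,
      ∑ᶠ M ∈ {M : Submodule 𝒪[K] (Fin 3 → K) | M ∈ stratum σ ϖ T ![2 * ρ + s, 2 * ρ + s, 2 * ρ] ∧
          (LatticeInLevel ϖ (d % 2) (Matrix.diagonal ![α - 1, β - 1, 0]) M ∧ ¬ LatticeInLevel ϖ (d % 2 + 1) (Matrix.diagonal ![α - 1, β - 1, 0]) M ∧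
            LatticeInLevel ϖ (mcOfRecord d) (Matrix.diagonal ![(α - 1) * (α - 1), (β - 1) * (β - 1), 0]) M)},
        (labelledOddCount σ ϖ 0 i (valueClassLabel σ ϖ (α - 1) (β - 1) (mstarOfRecord d) d) M : ℚ) /
          ((((unitStabilizer M).map (unitNormMap σ 3)).relIndex (fixedUnitTorus σ 3) : ℕ) : ℚ) = 0)
    (hR6₃ : ∀ (ρ s : ℕ), 1 ≤ ρ → 1 ≤ s → 2 ∣ s → 2 * ρ + d % 2 = n₂ → n₃ ≠ n₂ + s → ∀ i : Fin 3,
      ∑ᶠ M ∈ {M : Submodule 𝒪[K] (Fin 3 → K) | M ∈ stratum σ ϖ T ![2 * ρ + s, 2 * ρ + s, 2 * ρ] ∧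
          (LatticeInLevel ϖ (d % 2) (Matrix.diagonal ![α - 1, β - 1, 0]) M ∧ ¬ LatticeInLevel ϖ (d % 2 + 1) (Matrix.diagonal ![α - 1, β - 1, 0]) M ∧
            LatticeInLevel ϖ (mcOfRecord d) (Matrix.diagonal ![(α - 1) * (α - 1), (β - 1) * (β - 1), 0]) M)},
        (labelledOddCount σ ϖ 0 i (valueClassLabel σ ϖ (α - 1) (β - 1) (mstarOfRecord d) d) M : ℚ) /
          ((((unitStabilizer M).map (unitNormMap σ 3)).relIndex (fixedUnitTorus σ 3) : ℕ) : ℚ) =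
      (![(0 : ℚ), 0, (normSign σ (-1 : K) : ℚ) * (normSign σ eB : ℚ) + (normSign σ (-1 : K) : ℚ) * (normSign σ eA : ℚ)] : Fin 3 → ℚ) i / 4 * (Fintype.card 𝓀[K] : ℚ) ^ (2 * ρ - 1 + s / 2)
        * ((if 2 * d + d % 2 + 2 * ρ + s ≤ n₃ then (Fintype.card 𝓀[K] : ℚ) - 1 else 0) - (if n₃ + 2 = 2 * d + d % 2 + 2 * ρ + s then 1 else 0))) :
    (∑ a : Fin 3 → Fin (n₁ + n₂ + n₃ + 1),
      (if IsRestShape d n₁ n₂ n₃ (fun j => (a j : ℕ)) then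
        ∑ᶠ M ∈ {M : Submodule 𝒪[K] (Fin 3 → K) | M ∈ stratum σ ϖ T (fun j => (a j : ℕ)) ∧
            (LatticeInLevel ϖ (d % 2) (Matrix.diagonal ![α - 1, β - 1, 0]) M ∧ ¬ LatticeInLevel ϖ (d % 2 + 1) (Matrix.diagonal ![α - 1, β - 1, 0]) M ∧
              LatticeInLevel ϖ (mcOfRecord d) (Matrix.diagonal ![(α - 1) * (α - 1), (β - 1) * (β - 1), 0]) M)},
          (labelledOddCount σ ϖ 0 i (valueClassLabel σ ϖ (α - 1) (β - 1) (mstarOfRecord d) d) M : ℚ) /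
            ((((unitStabilizer M).map (unitNormMap σ 3)).relIndex (fixedUnitTorus σ 3) : ℕ) : ℚ)
       else 0)) =
      restTarget (Fintype.card 𝓀[K]) d n₁ n₂ n₃ (normSign σ eA) (normSign σ eB) (normSign σ eC) (normSign σ (-1 : K)) i := by
  -- the derived record's letters
  have h2d : 2 ≤ d := two_le_d_of_v_two_lt_one hD h2
  have hreg0 := three_mul_sub_two_add_mod_le_n0DerivedOfRecord d
  have hn₁ : n0DerivedOfRecord d ≤ n₁ := hE.2.2.2.2.2.2.2.2.1
  have hn₂ : n0DerivedOfRecord d ≤ n₂ := hE.2.2.2.2.2.2.2.2.2.1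
  have hn₃ : n0DerivedOfRecord d ≤ n₃ := hE.2.2.2.2.2.2.2.2.2.2
  have hdN₀ : d ≤ n0DerivedOfRecord d := le_trans (by omega) hreg0
  have hiso := isoceles_of_isElementDatum hD hE
  obtain ⟨hp1, hp2, hp3⟩ := depth_mod_two_eq_of_isElementDatum hD hE hdN₀
  -- ★ assembly at LH4-p10's letters, `harith` := ★ `harith_of_values`
  exact restSum_eq_of_rows h2 hD hE T hT i
    (fun ρ => (if 2 * ρ + d % 2 = min n₁ n₂ then
        (![if n₂ = n₃ then ((normSign σ eA : ℚ) + (normSign σ (-1 : K) : ℚ) * (normSign σ eC : ℚ)) / 4 * (Fintype.card 𝓀[K] : ℚ) ^ (n₂ - d % 2 - 1)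
            * ((if n₂ + 2 * d ≤ n₁ then (Fintype.card 𝓀[K] : ℚ) - 2 else 0) - (if n₁ + 2 = n₂ + 2 * d then 2 else 0)) else 0,
          if n₁ = n₃ then ((normSign σ eB : ℚ) + (normSign σ eC : ℚ)) / 4 * (Fintype.card 𝓀[K] : ℚ) ^ (n₁ - d % 2 - 1)
            * ((if n₁ + 2 * d ≤ n₂ then (Fintype.card 𝓀[K] : ℚ) - 2 else 0) - (if n₂ + 2 = n₁ + 2 * d then 2 else 0)) else 0,
          if n₁ = n₂ then ((normSign σ (-1 : K) : ℚ) * (normSign σ eB : ℚ) + (normSign σ (-1 : K) : ℚ) * (normSign σ eA : ℚ)) / 4 * (Fintype.card 𝓀[K] : ℚ) ^ (n₁ - d % 2 - 1)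
            * ((if n₁ + 2 * d ≤ n₃ then (Fintype.card 𝓀[K] : ℚ) - 2 else 0) - (if n₃ + 2 = n₁ + 2 * d then 2 else 0)) else 0] : Fin 3 → ℚ) i
       else 0))
    (fun ρ s i => (![(normSign σ eA : ℚ) + (normSign σ (-1 : K) : ℚ) * (normSign σ eC : ℚ), 0, 0] : Fin 3 → ℚ) i / 4 * (Fintype.card 𝓀[K] : ℚ) ^ (2 * ρ - 1 + s / 2)
      * ((if 2 * d + d % 2 + 2 * ρ + s ≤ n₁ then (Fintype.card 𝓀[K] : ℚ) - 1 else 0) - (if n₁ + 2 = 2 * d + d % 2 + 2 * ρ + s then 1 else 0)))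
    (fun ρ s i => (![(0 : ℚ), (normSign σ eB : ℚ) + (normSign σ eC : ℚ), 0] : Fin 3 → ℚ) i / 4 * (Fintype.card 𝓀[K] : ℚ) ^ (2 * ρ - 1 + s / 2)
      * ((if 2 * d + d % 2 + 2 * ρ + s ≤ n₂ then (Fintype.card 𝓀[K] : ℚ) - 1 else 0) - (if n₂ + 2 = 2 * d + d % 2 + 2 * ρ + s then 1 else 0)))
    (fun ρ s i => (![(0 : ℚ), 0, (normSign σ (-1 : K) : ℚ) * (normSign σ eB : ℚ) + (normSign σ (-1 : K) : ℚ) * (normSign σ eA : ℚ)] : Fin 3 → ℚ) i / 4 * (Fintype.card 𝓀[K] : ℚ) ^ (2 * ρ - 1 + s / 2)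
      * ((if 2 * d + d % 2 + 2 * ρ + s ≤ n₃ then (Fintype.card 𝓀[K] : ℚ) - 1 else 0) - (if n₃ + 2 = 2 * d + d % 2 + 2 * ρ + s then 1 else 0)))
    (fun k ρ s => (![if 2 * ρ + d % 2 = n₂ ∧ n₁ ≠ n₂ + s then (![(normSign σ eA : ℚ) + (normSign σ (-1 : K) : ℚ) * (normSign σ eC : ℚ), 0, 0] : Fin 3 → ℚ) i / 4 * (Fintype.card 𝓀[K] : ℚ) ^ (2 * ρ - 1 + s / 2)
          * ((if 2 * d + d % 2 + 2 * ρ + s ≤ n₁ then (Fintype.card 𝓀[K] : ℚ) - 1 else 0) - (if n₁ + 2 = 2 * d + d % 2 + 2 * ρ + s then 1 else 0)) else 0,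
        if 2 * ρ + d % 2 = n₁ ∧ n₂ ≠ n₁ + s then (![(0 : ℚ), (normSign σ eB : ℚ) + (normSign σ eC : ℚ), 0] : Fin 3 → ℚ) i / 4 * (Fintype.card 𝓀[K] : ℚ) ^ (2 * ρ - 1 + s / 2)
          * ((if 2 * d + d % 2 + 2 * ρ + s ≤ n₂ then (Fintype.card 𝓀[K] : ℚ) - 1 else 0) - (if n₂ + 2 = 2 * d + d % 2 + 2 * ρ + s then 1 else 0)) else 0,
        if 2 * ρ + d % 2 = n₂ ∧ n₃ ≠ n₂ + s then (![(0 : ℚ), 0, (normSign σ (-1 : K) : ℚ) * (normSign σ eB : ℚ) + (normSign σ (-1 : K) : ℚ) * (normSign σ eA : ℚ)] : Fin 3 → ℚ) i / 4 * (Fintype.card 𝓀[K] : ℚ) ^ (2 * ρ - 1 + s / 2)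
          * ((if 2 * d + d % 2 + 2 * ρ + s ≤ n₃ then (Fintype.card 𝓀[K] : ℚ) - 1 else 0) - (if n₃ + 2 = 2 * d + d % 2 + 2 * ρ + s then 1 else 0)) else 0] : Fin 3 → ℚ) k)
    _ hH hC₁ hR6₁ hC₂ hR6₂ hF₃ hR6₃ (fun _ _ => rfl) (fun _ _ => rfl) (fun _ _ => rfl)
    (harith_of_values (Fintype.card 𝓀[K]) h2d hiso ⟨le_trans hreg0 hn₁, le_trans hreg0 hn₂, le_trans hreg0 hn₃⟩ hp1 hp2 hp3 i
      (normSign σ eA) (normSign σ eB) (normSign σ eC) (normSign σ (-1 : K))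
      (fun ρ => (if 2 * ρ + d % 2 = min n₁ n₂ then
        (![if n₂ = n₃ then ((normSign σ eA : ℚ) + (normSign σ (-1 : K) : ℚ) * (normSign σ eC : ℚ)) / 4 * (Fintype.card 𝓀[K] : ℚ) ^ (n₂ - d % 2 - 1)
            * ((if n₂ + 2 * d ≤ n₁ then (Fintype.card 𝓀[K] : ℚ) - 2 else 0) - (if n₁ + 2 = n₂ + 2 * d then 2 else 0)) else 0,
          if n₁ = n₃ then ((normSign σ eB : ℚ) + (normSign σ eC : ℚ)) / 4 * (Fintype.card 𝓀[K] : ℚ) ^ (n₁ - d % 2 - 1)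
            * ((if n₁ + 2 * d ≤ n₂ then (Fintype.card 𝓀[K] : ℚ) - 2 else 0) - (if n₂ + 2 = n₁ + 2 * d then 2 else 0)) else 0,
          if n₁ = n₂ then ((normSign σ (-1 : K) : ℚ) * (normSign σ eB : ℚ) + (normSign σ (-1 : K) : ℚ) * (normSign σ eA : ℚ)) / 4 * (Fintype.card 𝓀[K] : ℚ) ^ (n₁ - d % 2 - 1)
            * ((if n₁ + 2 * d ≤ n₃ then (Fintype.card 𝓀[K] : ℚ) - 2 else 0) - (if n₃ + 2 = n₁ + 2 * d then 2 else 0)) else 0] : Fin 3 → ℚ) i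
       else 0))
      (fun k ρ s => (![if 2 * ρ + d % 2 = n₂ ∧ n₁ ≠ n₂ + s then (![(normSign σ eA : ℚ) + (normSign σ (-1 : K) : ℚ) * (normSign σ eC : ℚ), 0, 0] : Fin 3 → ℚ) i / 4 * (Fintype.card 𝓀[K] : ℚ) ^ (2 * ρ - 1 + s / 2)
          * ((if 2 * d + d % 2 + 2 * ρ + s ≤ n₁ then (Fintype.card 𝓀[K] : ℚ) - 1 else 0) - (if n₁ + 2 = 2 * d + d % 2 + 2 * ρ + s then 1 else 0)) else 0,
        if 2 * ρ + d % 2 = n₁ ∧ n₂ ≠ n₁ + s then (![(0 : ℚ), (normSign σ eB : ℚ) + (normSign σ eC : ℚ), 0] : Fin 3 → ℚ) i / 4 * (Fintype.card 𝓀[K] : ℚ) ^ (2 * ρ - 1 + s / 2)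
          * ((if 2 * d + d % 2 + 2 * ρ + s ≤ n₂ then (Fintype.card 𝓀[K] : ℚ) - 1 else 0) - (if n₂ + 2 = 2 * d + d % 2 + 2 * ρ + s then 1 else 0)) else 0,
        if 2 * ρ + d % 2 = n₂ ∧ n₃ ≠ n₂ + s then (![(0 : ℚ), 0, (normSign σ (-1 : K) : ℚ) * (normSign σ eB : ℚ) + (normSign σ (-1 : K) : ℚ) * (normSign σ eA : ℚ)] : Fin 3 → ℚ) i / 4 * (Fintype.card 𝓀[K] : ℚ) ^ (2 * ρ - 1 + s / 2)
          * ((if 2 * d + d % 2 + 2 * ρ + s ≤ n₃ then (Fintype.card 𝓀[K] : ℚ) - 1 else 0) - (if n₃ + 2 = 2 * d + d % 2 + 2 * ρ + s then 1 else 0)) else 0] : Fin 3 → ℚ) k)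
      (fun ρ s => (![(normSign σ eA : ℚ) + (normSign σ (-1 : K) : ℚ) * (normSign σ eC : ℚ), 0, 0] : Fin 3 → ℚ) i / 4 * (Fintype.card 𝓀[K] : ℚ) ^ (2 * ρ - 1 + s / 2)
        * ((if 2 * d + d % 2 + 2 * ρ + s ≤ n₁ then (Fintype.card 𝓀[K] : ℚ) - 1 else 0) - (if n₁ + 2 = 2 * d + d % 2 + 2 * ρ + s then 1 else 0)))
      (fun ρ s => (![(0 : ℚ), (normSign σ eB : ℚ) + (normSign σ eC : ℚ), 0] : Fin 3 → ℚ) i / 4 * (Fintype.card 𝓀[K] : ℚ) ^ (2 * ρ - 1 + s / 2)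
        * ((if 2 * d + d % 2 + 2 * ρ + s ≤ n₂ then (Fintype.card 𝓀[K] : ℚ) - 1 else 0) - (if n₂ + 2 = 2 * d + d % 2 + 2 * ρ + s then 1 else 0)))
      (fun ρ s => (![(0 : ℚ), 0, (normSign σ (-1 : K) : ℚ) * (normSign σ eB : ℚ) + (normSign σ (-1 : K) : ℚ) * (normSign σ eA : ℚ)] : Fin 3 → ℚ) i / 4 * (Fintype.card 𝓀[K] : ℚ) ^ (2 * ρ - 1 + s / 2)
        * ((if 2 * d + d % 2 + 2 * ρ + s ≤ n₃ then (Fintype.card 𝓀[K] : ℚ) - 1 else 0) - (if n₃ + 2 = 2 * d + d % 2 + 2 * ρ + s then 1 else 0)))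
      (fun ρ _ _ hne => if_neg hne) (fun ρ _ heq => if_pos heq)
      (fun _ _ => rfl) (fun _ _ => rfl) (fun _ _ => rfl)
      (fun _ _ _ _ _ _ => rfl) (fun _ _ _ _ _ _ => rfl) (fun _ _ _ _ _ _ => rfl))

end Summit.HodgeConjecture.HodgeConjecture.Cruxes.H413.F0P3cDyRamOddLabelledRestOfRows

end
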